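import Mathlib.Topology.Connected.PathConnected
import Literature.Probability.RandomPlanarGeometry.Curve

/-!
# Gluing simple arcs: injective paths, weak arcs and their concatenation
# (route `SAWReversalUpgrade`, helper for item `AttachmentExists`, stmt-CriticalPhenomena-18009)

The standard boundary attachment of the route is a simple arc obtained by gluing three pieces
(access segment, squeezed trimmed polyline, exit ray), some of which may degenerate to a point.
This file provides the elementary gluing language, with no new definition: a *weak arc from
`x` to `y` with trace `A`* is the disjunction
`(x = y ∧ A = {x}) ∨ ∃ γ : Path x y, Injective γ ∧ range γ = A`.

* `arcs_trans_injective` — `Path.trans` of two injective paths meeting only at the junction is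
  injective;
* `arcs_append` — weak arcs `x → y` (trace `A`) and `y → z` (trace `B`) with `A ∩ B ⊆ {y}`
  glue to a weak arc `x → z` with trace `A ∪ B`;
* `arcs_of_continuousOn_injOn` — a map continuous and injective on `[a, b]` (`a ≤ b`)
  parametrises a weak arc;
* `arcs_exists_curve` — a weak arc between distinct points is an injective `Curve` with the
  prescribed endpoints and range.

Folklore point-set topology.
-/

noncomputable section

namespace Summit.CriticalPhenomena.SAWScalingLimit.Theorems

open Set Function
open scoped unitInterval

/-- **`Path.trans` of two injective paths meeting only at the junction point is injective.**
[folklore] -/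
theorem arcs_trans_injective {X : Type*} [TopologicalSpace X] {x y z : X} {γ₁ : Path x y}
    {γ₂ : Path y z} (h₁ : Injective γ₁) (h₂ : Injective γ₂)
    (hI : range γ₁ ∩ range γ₂ ⊆ {y}) : Injective (γ₁.trans γ₂) := by
  intro s t hst
  rw [Path.trans_apply, Path.trans_apply] at hst
  -- a common value of the two halves is the junction `y`, taken only at the junction times
  have key : ∀ {s t : I} (hs : (s : ℝ) ≤ 1 / 2) (ht : ¬ (t : ℝ) ≤ 1 / 2),
      γ₁ ⟨2 * s, (unitInterval.mul_pos_mem_iff zero_lt_two).2 ⟨s.2.1, hs⟩⟩ =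
        γ₂ ⟨2 * t - 1, unitInterval.two_mul_sub_one_mem_iff.2 ⟨(not_le.1 ht).le, t.2.2⟩⟩ →
      False := by
    intro s t hs ht heq
    have hy : γ₁ ⟨2 * s, (unitInterval.mul_pos_mem_iff zero_lt_two).2 ⟨s.2.1, hs⟩⟩ = y :=
      hI ⟨⟨_, rfl⟩, ⟨_, heq.symm⟩⟩
    have hy' : γ₂ ⟨2 * t - 1, unitInterval.two_mul_sub_one_mem_iff.2
        ⟨(not_le.1 ht).le, t.2.2⟩⟩ = y := by rw [← heq, hy]
    have h0 : γ₂ ⟨2 * t - 1, unitInterval.two_mul_sub_one_mem_iff.2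
        ⟨(not_le.1 ht).le, t.2.2⟩⟩ = γ₂ 0 := by rw [hy', γ₂.source]
    have h0' := congrArg Subtype.val (h₂ h0)
    simp only [Icc.coe_zero] at h0'
    have : (t : ℝ) ≤ 1 / 2 := by linarith
    exact ht this
  by_cases hs : (s : ℝ) ≤ 1 / 2 <;> by_cases ht : (t : ℝ) ≤ 1 / 2
  · rw [dif_pos hs, dif_pos ht] at hst
    have h := congrArg Subtype.val (h₁ hst)
    exact Subtype.ext (by simpa using h)
  · rw [dif_pos hs, dif_neg ht] at hst
    exact (key hs ht hst).elim
  · rw [dif_neg hs, dif_pos ht] at hst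
    exact (key ht hs hst.symm).elim
  · rw [dif_neg hs, dif_neg ht] at hst
    have h := congrArg Subtype.val (h₂ hst)
    exact Subtype.ext (by simpa using h)

/-- **Gluing weak arcs.** A weak arc from `x` to `y` with trace `A` followed by a weak arc from
`y` to `z` with trace `B`, the traces meeting only at `y`, is a weak arc from `x` to `z` with
trace `A ∪ B`. [folklore] -/
theorem arcs_append {X : Type*} [TopologicalSpace X] {A B : Set X} {x y z : X}
    (hA : (x = y ∧ A = {x}) ∨ ∃ γ : Path x y, Injective γ ∧ range γ = A)
    (hB : (y = z ∧ B = {y}) ∨ ∃ γ : Path y z, Injective γ ∧ range γ = B)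
    (hI : A ∩ B ⊆ {y}) :
    (x = z ∧ A ∪ B = {x}) ∨ ∃ γ : Path x z, Injective γ ∧ range γ = A ∪ B := by
  rcases hA with ⟨rfl, rfl⟩ | ⟨γ₁, h₁, rfl⟩ <;> rcases hB with ⟨rfl, rfl⟩ | ⟨γ₂, h₂, rfl⟩
  · exact Or.inl ⟨rfl, union_self _⟩
  · refine Or.inr ⟨γ₂, h₂, ?_⟩
    rw [eq_comm, union_eq_right]
    exact singleton_subset_iff.2 ⟨0, γ₂.source⟩
  · refine Or.inr ⟨γ₁, h₁, ?_⟩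
    rw [eq_comm, union_eq_left]
    exact singleton_subset_iff.2 ⟨1, γ₁.target⟩
  · exact Or.inr ⟨γ₁.trans γ₂, arcs_trans_injective h₁ h₂ hI, Path.trans_range _ _⟩

/-- **A continuous injective parametrisation on `[a, b]` gives a weak arc** from `f a` to `f b`
with trace `f '' [a, b]` (a point if `a = b`, an injective path after affine reparametrisation
by `[0, 1]` if `a < b`). [folklore] -/
theorem arcs_of_continuousOn_injOn {X : Type*} [TopologicalSpace X] {f : ℝ → X} {a b : ℝ}
    (hab : a ≤ b) (hc : ContinuousOn f (Icc a b)) (hi : InjOn f (Icc a b)) :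
    (f a = f b ∧ f '' Icc a b = {f a}) ∨
      ∃ γ : Path (f a) (f b), Injective γ ∧ range γ = f '' Icc a b := by
  rcases hab.eq_or_lt with rfl | hlt
  · exact Or.inl ⟨rfl, by rw [Icc_self, image_singleton]⟩
  · right
    have hmem : ∀ t : I, a + (t : ℝ) * (b - a) ∈ Icc a b := fun t =>
      ⟨le_add_of_nonneg_right (mul_nonneg t.2.1 (sub_nonneg.2 hab)),
        by nlinarith [t.2.1, t.2.2, sub_pos.2 hlt]⟩
    have hcont : Continuous fun t : I => f (a + (t : ℝ) * (b - a)) :=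
      hc.comp_continuous (by fun_prop) hmem
    refine ⟨⟨⟨fun t => f (a + (t : ℝ) * (b - a)), hcont⟩, by simp, by simp⟩, ?_, ?_⟩
    · intro s t hst
      have h := hi (hmem s) (hmem t) hst
      have h' : (s : ℝ) * (b - a) = (t : ℝ) * (b - a) := by linarith
      exact Subtype.ext (mul_right_cancel₀ (sub_pos.2 hlt).ne' h')
    · ext p
      simp only [mem_range, Path.coe_mk_mk, mem_image, mem_Icc]
      constructor
      · rintro ⟨t, rfl⟩
        exact ⟨_, hmem t, rfl⟩
      · rintro ⟨u, hu, rfl⟩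
        refine ⟨⟨(u - a) / (b - a), div_nonneg (sub_nonneg.2 hu.1) (sub_nonneg.2 hab),
          (div_le_one (sub_pos.2 hlt)).2 (by linarith [hu.2])⟩, ?_⟩
        simp only
        rw [div_mul_cancel₀ _ (sub_pos.2 hlt).ne', add_sub_cancel]

/-- **A weak arc between distinct points of the plane is an injective curve** with the given
endpoints and range (`Curve` of the tree, `Curve.lean`). [folklore] -/
theorem arcs_exists_curve {X : Type*} [TopologicalSpace X] {x y : X} {S : Set X} (hxy : x ≠ y)
    (h : (x = y ∧ S = {x}) ∨ ∃ γ : Path x y, Injective γ ∧ range γ = S) :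
    ∃ c : Literature.Probability.RandomPlanarGeometry.Curve X, Injective c ∧ c.source = x ∧
      c.target = y ∧ range c = S := by
  rcases h with ⟨h, -⟩ | ⟨γ, hγ, rfl⟩
  · exact absurd h hxy
  · exact ⟨⟨γ.toContinuousMap⟩, hγ, γ.source, γ.target, rfl⟩

/-- Monotonicity of weak arcs in the trace: rewriting the trace along a set equality.
[folklore] -/
theorem arcs_congr {X : Type*} [TopologicalSpace X] {A B : Set X} {x y : X} (hAB : A = B)
    (hA : (x = y ∧ A = {x}) ∨ ∃ γ : Path x y, Injective γ ∧ range γ = A) :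
    (x = y ∧ B = {x}) ∨ ∃ γ : Path x y, Injective γ ∧ range γ = B := hAB ▸ hA

/-- The trace of a weak arc contains its endpoints. [folklore] -/
theorem arcs_endpoints_mem {X : Type*} [TopologicalSpace X] {A : Set X} {x y : X}
    (hA : (x = y ∧ A = {x}) ∨ ∃ γ : Path x y, Injective γ ∧ range γ = A) :
    x ∈ A ∧ y ∈ A := by
  rcases hA with ⟨rfl, rfl⟩ | ⟨γ, -, rfl⟩
  · exact ⟨rfl, rfl⟩
  · exact ⟨⟨0, γ.source⟩, ⟨1, γ.target⟩⟩

end Summit.CriticalPhenomena.SAWScalingLimit.Theorems
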